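import Summits.CriticalPhenomena.SAWScalingLimit.Theorems.SAWWeldingIdentificationWeldingLawOfLimitReductions
import Summits.CriticalPhenomena.SAWScalingLimit.Theorems.SAWWeldingIdentificationRemovableLimitS1IsSimpleSubseqLimits

/-!
# `WeldingLawOfLimit` (stmt-CriticalPhenomena-4502) implies `SimpleSubseqLimits` (stmt-CriticalPhenomena-4982)

Route `SAWWeldingIdentification`, crux (W) `WeldingLawOfLimit`; support file of the crux line
`registered` (lead c1), sequel to `…WeldingLawOfLimitReductions`.

* `simpleSubseqLimits_of_weldingLawOfLimit` — **stmt-4502 ⇒ stmt-4982** at item level: the crux forces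
  chord support of every subsequential weak limit of the critical SAW laws in EVERY Dobrushin domain
  along every sequence `sₙ → 0⁺`. It is the pointwise chord-support consequence of (W)
  (`ae_isSimpleChord_of_weldingLawOfLimit`, first file) fed into the sibling lead's transfer
  `RemovableLimit.simpleSubseqLimits_of_stub` (every Dobrushin domain is `Q.chord 0 2`; shift the
  sequence past its finitely many non-positive terms).

Together with the first file: `0783 ⇒ 4502 ⇒ 4982` and `4502 ∧ 4503 ⇒ 0783`, all kernel-checked; and
with `RemovableLimit.simpleSubseqLimits_of_removableLimit` (`4503 ⇒ 4982`) the three cruxes of the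
welding route sit above the shared simplicity crux. No new definition, no named fact.
-/

noncomputable section

open Summit.CriticalPhenomena.SAWScalingLimit.Theses

namespace Summit.CriticalPhenomena.SAWScalingLimit.Theorems.WeldingLawOfLimit

/-- **stmt-4502 ⇒ stmt-4982.** `WeldingLawOfLimit` implies the shared crux `SimpleSubseqLimits`: for
every Dobrushin domain, endpoint approximation, sequence `sₙ → 0` within `(0, ∞)` and probability
measure `ν` that is the weak limit of the pushed-forward critical SAW laws along `sₙ`, `ν`-almost every
curve class is a simple chord of `(Ω; a, b)`. Proof: `ae_isSimpleChord_of_weldingLawOfLimit` gives the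
statement for domains `Q.chord 0 2` and positive sequences, which is the registered stub S1 of the
sibling crux `RemovableLimit`; `RemovableLimit.simpleSubseqLimits_of_stub` upgrades it. [folklore] -/
theorem simpleSubseqLimits_of_weldingLawOfLimit :
    SAWWeldingIdentification.WeldingLawOfLimit → SAWLoopFugacityFlow.SimpleSubseqLimits :=
  fun hW => RemovableLimit.simpleSubseqLimits_of_stub (ae_isSimpleChord_of_weldingLawOfLimit hW)

end Summit.CriticalPhenomena.SAWScalingLimit.Theorems.WeldingLawOfLimit

end
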